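import Literature.MathematicalPhysics.QuantumLattice.XYZGroundStateOrderPlaquetteEnergy
import Literature.MathematicalPhysics.QuantumLattice.XYZGroundStateOrderSpinHalfHolds
import HarnessLib

/-!
# Ground-state planar order of the spin-½ XXZ model on `ℤ²`: the window `0 ≤ Δ ≤ 0.15`

Topic `MathematicalPhysics/QuantumLattice`; sibling proof file of `XYZGroundStateOrder.lean`.
Björnberg–Ueltschi (2022, Thm. 3.2 and p. 11) print the spin-½ planar window
`-J⁽²⁾/J⁽¹⁾ ∈ [0, 0.109]` and report Kubo–Kishi's `[0, 0.13)` (PRL 61 (1988) 2585) as "the current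
best result"; Wischmann–Müller-Hartmann (J. Phys. I 1 (1991) 647) print `[0, 0.22]` with
Lanczos-computed (uncertified) energy inputs (`wischmannMullerHartmann1991_ground_lro_spinHalf`,
a named fact of `XYZGroundStateOrder.lean`). This file PROVES the window `[0, 0.15]`
(`xxz_ground_lro_spinHalf_window`), i.e. discharges the part `Δ ≤ 0.15` of that fact, by the
tree's certified B–U/KLS assembly (`XYZGroundStateOrderProofs.lean`: sum rule, `T = 0` infrared
bound from Gaussian domination, Kubo's orbit inequalities, certified Riemann sums `R_L ≤ 0.651`)
with ONE input replaced: the polarised-state bound `c⁰ + J₂c¹ + c² ≥ ¼` (B–U (3.10)) is replaced by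
the plaquette variational bound `c⁰ + J₂c¹ + c² ≥ 0.26067 - 0.02376 J₂`
(`xyz_plaquette_bound`, `XYZGroundStateOrderPlaquetteEnergy.lean`).

Contents: the elementary positivity lemma (`plaquette_positivity`: explicit polynomial
certificate, worst case at `-J₂ = 0.15`, margin `1/4000`), the finite-volume lower bound
`L⁻²ĝ⁰₀ ≥ 1/4000` (`xyz_lro_lower_bound_plaquette`), the assembly from Gaussian domination, and
the window theorem with its corollaries in the vocabulary of the named facts. No statement of
the tree is changed; the regime `0.15 < Δ ≤ 0.22` of W–MH and the near-Heisenberg regime stay open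
here.
-/

noncomputable section

open Matrix Finset Filter Topology
open scoped ComplexOrder
open Literature.MathematicalPhysics.QuantumLattice Literature.MathematicalPhysics.QuantumLattice.SpinOperators
  Literature.Probability.LatticeModels

namespace Literature.MathematicalPhysics.QuantumLattice

/-! ### Positivity of the lower bound on the window -/

/-- **Positivity of the lower bound, uniformly in the unknown `α'`, on the window `-J₂ ≤ 0.15`.**
If `α ≥ 0`, `c⁰ + α ≥ ε_v(J₂) := ½(535/10417 - 495J₂/10417 + 10001/41668 + (9991/20834)²)`
(the plaquette bound), `α ≤ (1 - J₂)c⁰` (B–U (4.42)), `0 ≤ -J₂ ≤ 0.15` and `R ≤ 0.651`, then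
`c⁰ - ½√α R ≥ 1/4000`. Proof: with `a = √α`, `ρ = -J₂`, either `(2+ρ)a² ≤ (1+ρ)ε_v` and then
`c⁰ ≥ ε_v - a²`, or not and then `c⁰ ≥ a²/(1+ρ)`; in each case an explicit sum-of-squares
certificate (multipliers `267/400`, `93/400`) gives `c⁰ - 0.3255a ≥ 1/4000`.
[cite: KuboKishi1988] [cite: BjornbergUeltschi2022, (3.9) and the paragraph after Thm. 3.2] -/
theorem plaquette_positivity {c0 α R J₂ : ℝ} (hα : 0 ≤ α)
    (hV : (1 / 2 : ℝ) * (1 * (535 / 10417) + J₂ * (-(495 / 10417)) + 10001 / 41668 + (9991 / 20834) ^ 2) ≤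
      c0 + α)
    (h442 : 1 * α ≤ (1 - J₂) * c0) (hJ₂ : 0 ≤ -J₂) (hJ₂' : -J₂ ≤ 0.15) (hR : R ≤ 651 / 1000) :
    1 / 4000 ≤ c0 - 1 / 2 * Real.sqrt α * R := by
  set a := Real.sqrt α with ha
  have ha0 : 0 ≤ a := Real.sqrt_nonneg α
  have haa : a * a = α := Real.mul_self_sqrt hα
  set ρ := -J₂ with hρ
  have hJ : J₂ = -ρ := by rw [hρ, neg_neg]
  -- the energy lower bound `ev = A + B ρ`
  set ev : ℝ := (1 / 2 : ℝ) * (1 * (535 / 10417) + (-ρ) * (-(495 / 10417)) + 10001 / 41668 +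
    (9991 / 20834) ^ 2) with hev
  have hV' : ev ≤ c0 + a * a := by rw [haa, hev, ← hJ]; exact hV
  have hQ : a * a ≤ (1 + ρ) * c0 := by rw [haa]; linarith
  have hc0 : 0 ≤ c0 := by
    by_contra hneg
    push Not at hneg
    have : (1 + ρ) * c0 < 0 := mul_neg_of_pos_of_neg (by linarith) hneg
    nlinarith
  have haR : 1 / 2 * a * R ≤ 651 / 2000 * a := by nlinarith
  suffices hmain : 1 / 4000 ≤ c0 - 651 / 2000 * a by linarith
  rcases le_or_gt ((2 + ρ) * (a * a)) ((1 + ρ) * ev) with h1 | h2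
  · -- the variational bound is active: `c0 ≥ ev - a²`
    set Lc : ℝ := 267 / 400 * (2 + ρ) - 1 with hLc
    have hLcpos : 0 < Lc := by rw [hLc]; linarith
    have hg : 0 ≤ 4 * Lc * (ev * (1 - 267 / 400 * (1 + ρ)) - 1 / 4000) - (651 / 2000) ^ 2 := by
      rw [hLc, hev]
      nlinarith [mul_nonneg hJ₂ hJ₂, mul_nonneg hJ₂ (sub_nonneg.2 hJ₂'),
        mul_nonneg (mul_nonneg hJ₂ hJ₂) (sub_nonneg.2 hJ₂')]
    have hkey : 0 ≤ 4 * Lc * (c0 - 651 / 2000 * a - 1 / 4000) := by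
      have hid : 4 * Lc * (c0 - 651 / 2000 * a - 1 / 4000) =
          4 * Lc * (c0 + a * a - ev) + 4 * (267 / 400) * Lc * ((1 + ρ) * ev - (2 + ρ) * (a * a)) +
            (2 * Lc * a - 651 / 2000) ^ 2 +
            (4 * Lc * (ev * (1 - 267 / 400 * (1 + ρ)) - 1 / 4000) - (651 / 2000) ^ 2) := by
        rw [hLc]; ring
      rw [hid]
      have h1' : 0 ≤ (1 + ρ) * ev - (2 + ρ) * (a * a) := by linarith
      have hV'' : 0 ≤ c0 + a * a - ev := by linarith
      positivity
    have := (mul_nonneg_iff_of_pos_left (by linarith : (0 : ℝ) < 4 * Lc)).1 hkey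
    linarith
  · -- B–U (4.42) is active: `c0 ≥ a²/(1+ρ)`
    set L₂ : ℝ := 1 - 93 / 400 * (2 + ρ) with hL₂
    have hL₂pos : 0 < L₂ := by rw [hL₂]; linarith
    have hg : 0 ≤ 4 * L₂ * (93 / 400 * ev * (1 + ρ) - 1 / 4000 * (1 + ρ)) - (651 / 2000) ^ 2 * (1 + ρ) ^ 2 := by
      rw [hL₂, hev]
      nlinarith [mul_nonneg hJ₂ hJ₂, mul_nonneg hJ₂ (sub_nonneg.2 hJ₂'),
        mul_nonneg (mul_nonneg hJ₂ hJ₂) (sub_nonneg.2 hJ₂')]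
    have hkey : 0 ≤ 4 * L₂ * ((1 + ρ) * (c0 - 651 / 2000 * a - 1 / 4000)) := by
      have hid : 4 * L₂ * ((1 + ρ) * (c0 - 651 / 2000 * a - 1 / 4000)) =
          4 * L₂ * ((1 + ρ) * c0 - a * a) + 4 * (93 / 400) * L₂ * ((2 + ρ) * (a * a) - (1 + ρ) * ev) +
            (2 * L₂ * a - 651 / 2000 * (1 + ρ)) ^ 2 +
            (4 * L₂ * (93 / 400 * ev * (1 + ρ) - 1 / 4000 * (1 + ρ)) - (651 / 2000) ^ 2 * (1 + ρ) ^ 2) := by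
        rw [hL₂]; ring
      rw [hid]
      have h2' : 0 ≤ (2 + ρ) * (a * a) - (1 + ρ) * ev := by linarith
      have hQ' : 0 ≤ (1 + ρ) * c0 - a * a := by linarith
      positivity
    have h3 := (mul_nonneg_iff_of_pos_left (by linarith : (0 : ℝ) < 4 * L₂)).1 hkey
    have h4 := (mul_nonneg_iff_of_pos_left (by linarith : (0 : ℝ) < 1 + ρ)).1 h3
    linarith

/-! ### The finite-volume lower bound on the window -/

/-- **The finite-volume lower bound on the window** (B–U Thm. 3.2, second bound, at `β = ∞`,
`d = 2`, `S = ½`, `J⁽¹⁾ = J⁽³⁾ = 1`, with the plaquette variational bound in place of (3.10)):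
on the torus of side `L = 2k ≥ 4`, for `0 ≤ -J₂ ≤ 0.15`, under Gaussian domination for
`H' = H(1, J₂, 1)` and `R_L(2) ≤ 0.651`, `L⁻² ĝ⁰_0 ≥ 1/4000`. The proof is that of
`xyz_lro_lower_bound` verbatim ((C) sum rule, (A) infrared bound, (O) orbit inequalities,
(4.42)), with `xyz_plaquette_bound` + `plaquette_positivity` in place of `xyz_polarised_bound` +
`bu_positivity`. [cite: KuboKishi1988] [cite: BjornbergUeltschi2022, Thm. 3.2 and (4.38)–(4.42)] -/
theorem xyz_lro_lower_bound_plaquette (k : ℕ) (hk : 2 ≤ k) (J₂ : ℝ) (hJ₂ : 0 ≤ -J₂) (hJ₂' : -J₂ ≤ 0.15)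
    (hGD : haveI : NeZero (2 * k) := ⟨by omega⟩
      ∀ h : TorusSite 2 (2 * k) → ℝ,
        (anisotropicTorus 2 (2 * k) 1 1 J₂ 1).groundEnergy ≤
          (anisotropicTorus 2 (2 * k) 1 1 J₂ 1 - (2 : ℂ) • xyGradField (2 * k) 1 h +
            ((xyFieldEnergy (2 * k) h : ℝ) : ℂ) • 1).groundEnergy)
    (hR : klsRiemannSum 2 (2 * k) ≤ 651 / 1000) :
    haveI : NeZero (2 * k) := ⟨by omega⟩
    (1 / 4000 : ℝ) ≤ xyzStructureFactor (2 * k) 1 1 J₂ (0 : TorusSite 2 (2 * k)) / ((2 * k : ℕ) : ℝ) ^ 2 := by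
  haveI : NeZero (2 * k) := ⟨by omega⟩
  haveI : NeZero k := ⟨by omega⟩
  have hL3 : 3 ≤ 2 * k := by omega
  have hd : (0 : ℕ) < 2 := by norm_num
  set L := 2 * k with hLdef
  have hLpos : (0 : ℝ) < ((L : ℕ) : ℝ) ^ 2 := by positivity
  set c0 := xyzBondCorr (d := 2) 0 L 1 1 J₂ with hc0
  set c1 := xyzBondCorr (d := 2) 1 L 1 1 J₂ with hc1
  set c2 := xyzBondCorr (d := 2) 2 L 1 1 J₂ with hc2
  set α' := J₂ * c1 + 1 * c2 with hα'
  set β' := 1 * c1 + J₂ * c2 with hβ'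
  -- (O): `α' ≥ 0`, `α' + β' ≥ 0`
  obtain ⟨-, hO2, hO3, -⟩ := xyz_orbit_inequalities 1 1 J₂ hd k hk
  have hαpos : 0 ≤ α' := hO2
  have hαβ : 0 ≤ α' + β' := by
    have : α' + β' = (1 + J₂) * (c1 + c2) := by rw [hα', hβ']; ring
    rw [this]; exact hO3
  -- (V'): the plaquette bound, and (4.42)
  have hV : (1 / 2 : ℝ) * (1 * (535 / 10417) + J₂ * (-(495 / 10417)) + 10001 / 41668 + (9991 / 20834) ^ 2) ≤
      c0 + α' := by
    have h := xyz_plaquette_bound (k := k) hk 1 J₂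
    rw [hα']
    linarith
  have h442 : 1 * α' ≤ (1 - J₂) * c0 := xyz_bu442 1 1 J₂ hd k hk one_pos le_rfl (by linarith) (by linarith)
  -- (C): the sum rule split at `q = 0`
  have hC := xyz_structureFactor_sumRule (by norm_num : 1 ≤ 2) L 1 1 J₂
  rw [← hc0, ← add_sum_erase _ _ (mem_univ (0 : TorusSite 2 L)), torusCosSum_zero] at hC
  -- (A): the infrared bound, pointwise
  have hsum : ∑ q ∈ (univ : Finset (TorusSite 2 L)).erase 0,
      xyzStructureFactor L 1 1 J₂ q * (torusCosSum L q / (2 : ℕ)) ≤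
      1 / 2 * Real.sqrt α' * ∑ q ∈ (univ : Finset (TorusSite 2 L)).erase 0,
        klsIntegrand 2 (latticeMomentum L q) := by
    rw [mul_sum]
    refine sum_le_sum fun q hq => ?_
    have hq0 : q ≠ 0 := (mem_erase.1 hq).1
    obtain ⟨hg, hAq⟩ := xyz_infraredBound_of_groundEnergy_le L 1 1 J₂ hL3 hd hGD q hq0
    rw [← hc1, ← hc2, ← hα', ← hβ', sum_const_sub_mul_cos_latticeMomentum] at hAq
    rw [klsIntegrand_latticeMomentum]
    exact bu_pointwise hg (dispersion_latticeMomentum_pos hq0) (by norm_num) hAq hαpos hαβ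
  -- `c⁰ ≤ L⁻² ĝ₀ + ½ √α' R`
  have hRsum : ∑ q ∈ (univ : Finset (TorusSite 2 L)).erase 0, klsIntegrand 2 (latticeMomentum L q) =
      klsRiemannSum 2 L * ((L : ℕ) : ℝ) ^ 2 := by
    rw [klsRiemannSum_of_neZero, div_mul_cancel₀ _ hLpos.ne']
  have hmain : c0 ≤ xyzStructureFactor L 1 1 J₂ (0 : TorusSite 2 L) / ((L : ℕ) : ℝ) ^ 2 +
      1 / 2 * Real.sqrt α' * klsRiemannSum 2 L := by
    have hC' : c0 * ((L : ℕ) : ℝ) ^ 2 = xyzStructureFactor L 1 1 J₂ (0 : TorusSite 2 L) * ((2 : ℕ) / (2 : ℕ)) +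
        ∑ q ∈ (univ : Finset (TorusSite 2 L)).erase 0,
          xyzStructureFactor L 1 1 J₂ q * (torusCosSum L q / (2 : ℕ)) := by
      rw [← hC, div_mul_cancel₀ _ hLpos.ne']
    rw [hRsum] at hsum
    have : c0 * ((L : ℕ) : ℝ) ^ 2 ≤ xyzStructureFactor L 1 1 J₂ (0 : TorusSite 2 L) +
        1 / 2 * Real.sqrt α' * (klsRiemannSum 2 L * ((L : ℕ) : ℝ) ^ 2) := by
      rw [hC', show ((2 : ℕ) : ℝ) / ((2 : ℕ) : ℝ) = 1 by norm_num, mul_one]; linarith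
    rw [div_add' _ _ _ hLpos.ne', le_div_iff₀ hLpos]
    nlinarith
  have hpos := plaquette_positivity hαpos hV h442 hJ₂ hJ₂' hR
  linarith

/-! ### Assembly: the window from Gaussian domination, and the window theorem -/

/-- **The window `-J₂ ≤ 0.15` from Gaussian domination**: if ground-state Gaussian domination
holds for the anisotropic Hamiltonians `anisotropicTorus 2 L 1 1 J₂ 1` on all even tori of side
`L ≥ 4` (all real fields) and the punctured Riemann sums satisfy `R_L(2) ≤ 0.651` eventually,
then for `0 ≤ -J₂ ≤ 0.15` the ground states have long-range order in the third direction: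
eventually `(2k)⁻⁴ Σ_{x,y} ⟨S²_xS²_y⟩ = (2k)⁻² ĝ⁰_0 ≥ 1/4000`.
[cite: KuboKishi1988] [cite: BjornbergUeltschi2022, Thm. 3.2 and p. 11] -/
theorem xxz_ground_lro_spinHalf_window_of_gaussianDomination
    (hGD : ∀ (L : ℕ) [NeZero L], Even L → 4 ≤ L → ∀ (J₂ : ℝ), J₂ ≤ 0 →
      ∀ h : TorusSite 2 L → ℝ,
        (anisotropicTorus 2 L 1 1 J₂ 1).groundEnergy ≤
          (anisotropicTorus 2 L 1 1 J₂ 1 - (2 : ℂ) • xyGradField L 1 h +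
            ((xyFieldEnergy L h : ℝ) : ℂ) • 1).groundEnergy)
    (hR : ∀ᶠ L : ℕ in atTop, klsRiemannSum 2 L ≤ 651 / 1000) (J₂ : ℝ) (hJ₂ : 0 ≤ -J₂)
    (hJ₂' : -J₂ ≤ 0.15) :
    HasEvenTorusLRO (fun L x y => groundStateAxisCorrTorus (d := 2) L 1 1 J₂ 1 x y) := by
  rw [hasEvenTorusLRO_iff]
  have h2k : Tendsto (fun k : ℕ => 2 * k) atTop atTop :=
    tendsto_atTop_atTop.2 fun b => ⟨b, fun k hk => by omega⟩
  have hRk : ∀ᶠ k : ℕ in atTop, klsRiemannSum 2 (2 * k) ≤ 651 / 1000 := h2k.eventually hR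
  have hev : ∀ᶠ k : ℕ in atTop, (1 / 4000 : ℝ) ≤
      (∑ x ∈ halfOpenBox 2 (2 * k), ∑ y ∈ halfOpenBox 2 (2 * k),
          torusPullback (fun L x y => groundStateAxisCorrTorus (d := 2) L 1 1 J₂ 1 x y) (2 * k) x y) /
        ((halfOpenBox 2 (2 * k)).card : ℝ) ^ 2 := by
    filter_upwards [hRk, eventually_ge_atTop 2] with k hk hk2
    haveI : NeZero (2 * k) := ⟨by omega⟩
    rw [xyz_lroSeq_eq 1 k (by omega) 1 J₂]
    exact xyz_lro_lower_bound_plaquette k hk2 J₂ hJ₂ hJ₂'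
      (fun h => hGD (2 * k) (even_two_mul k) (by omega) J₂ (by linarith) h) hk
  exact lt_of_lt_of_le (by norm_num : (0 : ℝ) < 1 / 4000)
    (le_liminf_of_le (isCoboundedUnder_ge_of_le atTop fun k => xyz_lroSeq_le 1 k 1 J₂) hev)

/-- **Ground-state planar long-range order of the spin-½ XXZ model on `ℤ²` for `0 ≤ Δ ≤ 0.15`.**
For `d = 2`, `S = ½` and `0 ≤ Δ ≤ 0.15`, the ground states (tracial ground-state functional) of
the nearest-neighbour model `-Σ_x Σ_{y∼x} (S⁽¹⁾S⁽¹⁾ - Δ S⁽²⁾S⁽²⁾ + S⁽³⁾S⁽³⁾)` on the even tori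
`(ℤ/2kℤ)²` — unitarily equivalent (sublattice rotation) to the spin-½ XXZ antiferromagnet
`Σ(SˣSˣ + SʸSʸ + ΔSᶻSᶻ)` — have long-range order in the third (planar) direction:
`liminf_k (2k)⁻⁴ Σ_{x,y} ⟨S⁽³⁾_xS⁽³⁾_y⟩ > 0`. This is the case `Δ ≤ 0.15` of the printed W–MH window
`[0, 0.22]` (`wischmannMullerHartmann1991_ground_lro_spinHalf`) and contains Kubo–Kishi's printed
`[0, 0.13)` and B–U's `[0, 0.109]`; here it is PROVED (reflection positivity ⇒ Gaussian domination
`buSpinHalf_gaussianDomination`, certified `R_L ≤ 0.651`, plaquette variational bound).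
[cite: WischmannMullerhartmann1991, Abstract (p. 647) and §5 (pp. 654–655, Table I)]
[cite: KuboKishi1988] -/
theorem xxz_ground_lro_spinHalf_window :
    ∀ (Δ : ℝ), 0 ≤ Δ → Δ ≤ 0.15 →
      HasEvenTorusLRO (fun L x y => groundStateAxisCorrTorus (d := 2) L 1 1 (-Δ) 1 x y) := by
  intro Δ hΔ hΔ'
  exact xxz_ground_lro_spinHalf_window_of_gaussianDomination
    (fun L _ hL h4 J₂ hJ₂ h => buSpinHalf_gaussianDomination L 1 hL h4 zero_le_one hJ₂ h)
    klsRiemannSum_two_eventually_le (-Δ) (by simpa using hΔ) (by simpa using hΔ')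

/-- The window in Björnberg–Ueltschi's parametrisation: the `J⁽¹⁾ = 1` slice of
`bjornbergUeltschi2022_ground_lro_spinHalf` extended from `-J⁽²⁾ ≤ 0.109` to `-J⁽²⁾ ≤ 0.15`.
[cite: BjornbergUeltschi2022, p. 11 (after (3.9))] [cite: KuboKishi1988] -/
theorem xxz_ground_lro_spinHalf_window' (J₂ : ℝ) (hJ₂ : 0 ≤ -J₂) (hJ₂' : -J₂ ≤ 0.15) :
    HasEvenTorusLRO (fun L x y => groundStateAxisCorrTorus (d := 2) L 1 1 J₂ 1 x y) := by
  have h := xxz_ground_lro_spinHalf_window (-J₂) hJ₂ hJ₂'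
  simpa using h

/-- **The part `Δ ≤ 0.15` of the Wischmann–Müller-Hartmann fact is a theorem**: any consequence
of `wischmannMullerHartmann1991_ground_lro_spinHalf` that only instantiates it at `Δ ≤ 0.15`
holds unconditionally. Stated as: the fact restricted to `[0, 0.15]`.
[cite: WischmannMullerhartmann1991, §5 (pp. 654–655, Table I)] -/
theorem wischmannMullerHartmann1991_ground_lro_spinHalf_of_le (Δ : ℝ) (hΔ : 0 ≤ Δ) (hΔ' : Δ ≤ 0.15) :
    HasEvenTorusLRO (fun L x y => groundStateAxisCorrTorus (d := 2) L 1 1 (-Δ) 1 x y) :=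
  xxz_ground_lro_spinHalf_window Δ hΔ hΔ'

end Literature.MathematicalPhysics.QuantumLattice

end
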